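import Literature.NumberTheory.ModularSymbols.CuspidalHomologyShiftNorm
import Literature.LinearAlgebra.CommutingFamilyFittingProjection
import Literature.Algebra.Module.IndependentModPrime
import Mathlib.RingTheory.TensorProduct.Finite
import Mathlib.RingTheory.Finiteness.Cardinality
import Mathlib.RingTheory.Artinian.Module
import Mathlib.Algebra.Algebra.Tower
import HarnessLib

/-!
# The mod-`n` fibres `V₁(ℤ/n) = Λ₁/nΛ₁` of the lattice `Λ₁ = (t − 1)H₁(X₀(N), ℤ)` and Hecke factoring on them

Sequel of `CuspidalHomologyShiftNorm` (p661679 · p662714: `shiftSubOneLattice N h9 = Λ₁ = range(t_* − 1)`,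
its operators `shiftOne` (`t`), `heckeOne` (`T_p`, `p ≠ 3`), the fibre module `ShiftSubOneModule N h9 R =
R ⊗_ℤ Λ₁` with `shiftOneR`, `heckeOneR`, and the generalised isotypic pieces `genIsotypicOne`), typed for the
bsd-stepL LINE 28 / `PS_of` step (bsd-idea-3 memo §13.10 (iii), `PS_of_plan.lean`). Everything is proved; no
named facts, no instances, no notation.

* §1 Finiteness: `Λ₁` is a finitely generated `ℤ`-module (a sublattice of `H₁(X₀(N), ℤ)`, Darmon–Diamond–Taylor
  §1.3 p. 27), `V₁(R)` a finitely generated `R`-module, finite and Artinian for finite `R`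
  (`moduleFinite_shiftSubOneLattice`, `moduleFinite_shiftSubOneModule`, `finite_shiftSubOneModule`,
  `isArtinian_shiftSubOneModule` — stated as theorems, to be introduced with `haveI`).
* §2 The fibre map `toFibre R : Λ₁ → V₁(R)`, `x ↦ 1 ⊗ x` (Hatcher §3.A: `H ⊗ ℤ/n`), its equivariance for `t` and
  `T_p` (`toFibre_shiftOne`, `toFibre_heckeOne`), `intCast_smul_toFibre`, generation (`span_range_toFibre`), and
  for `R = ℤ/n`: surjectivity (`toFibre_zmod_surjective`), **kernel `nΛ₁`** (`toFibre_zmod_eq_zero_iff`, from the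
  tree's `Literature.Algebra.Module.one_tmul_eq_zero_iff_exists_smul`, Stammbach II (3.11) `ℤ/n ⊗ M = M/nM`),
  `ℤ`-span = `ℤ/n`-span (`restrictScalars_span_zmod`), and the pull-back rule `mem_of_toFibre_mem_span_image`
  (a sublattice `G ⊇ nΛ₁` is recovered from the span of its image), `sub_smul_mem_span_image_of_forall`
  (an operator congruence `φ ≡ c (mod G)` on `Λ₁` gives `Φ ≡ c (mod span G̅)` on `V₁(ℤ/n)`).
* §3 `three_smul_mem_range_shiftOne_sub_one`: `3Λ₁ ⊆ (t − 1)Λ₁` (from `(1 − t)² = −3t` on `Λ₁`).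
* §4 Hecke factoring on the fibre: `genIsotypicOne_eq_biInf` (re-indexing by the primes `p ≠ 3` of a finite set
  `S`), **`map_genIsotypicOne_eq_top`** — a surjection `π : V₁(R) ↠ Q` (`R` finite) killing a power of each
  `T_p − a_p` (`p ∈ S`) maps the generalised eigenspace `V₁[a^∞]` ONTO `Q` (the tree's Fitting corollary
  `CommutingFamily.map_biInf_maxGenEigenspace_eq_top`; no rationality of Hecke eigenvalues needed) — and the
  punch line **`eq_top_of_genIsotypicOne_le`**: a submodule `W ≤ V₁(R)` modulo which every `T_p` (`p ∈ S`) is the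
  scalar `a_p`, and which contains `V₁[a^∞]`, is everything.

## References

* H. Darmon, F. Diamond, R. Taylor, *Fermat's Last Theorem*, in: Current Developments in Math. 1995, §1.3 p. 27
  (`H₁(X₀(N), ℤ)` a lattice of rank `2g`).
* A. Hatcher, *Algebraic Topology*, CUP 2002, §3.A, Cor. 3A.4 (coefficients `H ⊗ ℤ/n`).
* U. Stammbach, *Homology in Group Theory*, LNM 359, Springer 1973, II.3 (3.11) (`ℤ/n ⊗ A = A/nA`).
* N. Jacobson, *Basic Algebra II*, 2nd ed. 1989, §3.4 Fitting's lemma (38), p. 113.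
* F. Diamond, J. Shurman, *A First Course in Modular Forms*, GTM 228, 2005, §6.3 (Hecke eigenspaces).
* M. Harrison, *On the conjecture of Gross and Zagier* / the `X₀(108)` shift computations, 2011, §2 (the shift `t`).
-/

noncomputable section

namespace Literature.NumberTheory.ModularSymbols

open Literature.NumberTheory.EllipticCurves Literature.NumberTheory.EllipticCurves.ModularForms CongruenceSubgroup
open scoped TensorProduct

/-! ### §1 Finiteness of `Λ₁` and of its fibres -/

section Finiteness

variable (N : ℕ) [NeZero N] (h9 : 3 ^ 2 ∣ N)

/-- **`Λ₁` is a finitely generated `ℤ`-module** (a subgroup of the finitely generated `H₁(X₀(N), ℤ)`,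
the tree's `moduleFinite_int_periodHomologyHecke`; `ℤ` is Noetherian). [cite: DarmonDiamondTaylor1995, §1.3 (p. 27) (derived reading: sublattice of the rank-2g lattice Λ)] -/
theorem moduleFinite_shiftSubOneLattice : Module.Finite ℤ (shiftSubOneLattice N h9) := by
  haveI := moduleFinite_int_periodHomologyHecke N
  haveI : IsNoetherian ℤ (periodHomologyHecke N) := isNoetherian_of_isNoetherianRing_of_finite ℤ _
  infer_instance

variable (R : Type*) [CommRing R]

/-- **`V₁(R) = R ⊗ Λ₁` is a finitely generated `R`-module** (base change of §1's `Λ₁`).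
[cite: HatcherAT2002, §3.A Cor. 3A.4 (derived reading: coefficients R ⊗ H₁ of a finite complex)] -/
theorem moduleFinite_shiftSubOneModule : Module.Finite R (ShiftSubOneModule N h9 R) := by
  haveI := moduleFinite_shiftSubOneLattice N h9
  exact Module.Finite.base_change ℤ R (shiftSubOneLattice N h9)

/-- For a finite coefficient ring (`R = ℤ/n`, `n ≠ 0`), `V₁(R)` is a finite set.
[cite: HatcherAT2002, §3.A Cor. 3A.4 (derived reading)] -/
theorem finite_shiftSubOneModule [Finite R] : Finite (ShiftSubOneModule N h9 R) := by
  haveI := moduleFinite_shiftSubOneModule N h9 R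
  exact Module.finite_of_finite R

/-- For a finite coefficient ring, `V₁(R)` is an Artinian `R`-module (so Fitting's lemma applies to its Hecke
operators). [cite: Jacobson1989BasicAlgebraII, §3.4 (p. 113) (derived reading: finite modules satisfy both chain conditions)] -/
theorem isArtinian_shiftSubOneModule [Finite R] : IsArtinian R (ShiftSubOneModule N h9 R) := by
  haveI := finite_shiftSubOneModule N h9 R
  exact isArtinian_of_finite

end Finiteness

/-! ### §2 The fibre map `Λ₁ → V₁(R)`, `x ↦ 1 ⊗ x` -/

section Fibre

variable (N : ℕ) [NeZero N] (h9 : 3 ^ 2 ∣ N) (R : Type*) [CommRing R]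

/-- **The fibre (reduction) map `Λ₁ → V₁(R) = R ⊗ Λ₁`, `x ↦ 1 ⊗ x`** (for `R = ℤ/n`: reduction mod `n`,
`Λ₁ → Λ₁/nΛ₁`). [cite: HatcherAT2002, §3.A Cor. 3A.4] -/
def toFibre : shiftSubOneLattice N h9 →ₗ[ℤ] ShiftSubOneModule N h9 R :=
  TensorProduct.mk ℤ R (shiftSubOneLattice N h9) 1

/-- Unfolding `toFibre`. [cite: HatcherAT2002, §3.A Cor. 3A.4] -/
@[simp] theorem toFibre_apply (x : shiftSubOneLattice N h9) : toFibre N h9 R x = (1 : R) ⊗ₜ[ℤ] x :=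
  rfl

/-- `toFibre` intertwines `t` on `Λ₁` with `t` on `V₁(R)`. [cite: Harrison2011X0108, §2] -/
theorem toFibre_shiftOne (x : shiftSubOneLattice N h9) :
    toFibre N h9 R (shiftOne N h9 x) = shiftOneR N h9 R (toFibre N h9 R x) := by
  rw [toFibre_apply, toFibre_apply, shiftOneR_tmul]

variable {N R} in
/-- `toFibre` intertwines `T_p` on `Λ₁` with `T_p` on `V₁(R)` (`p ≠ 3`). [cite: DiamondShurman2005, Prop. 5.2.2(a) (derived reading, see `heckeOne`)] -/
theorem toFibre_heckeOne {p : ℕ} (hp : p.Prime) (hp3 : p ≠ 3) (x : shiftSubOneLattice N h9) :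
    toFibre N h9 R (heckeOne h9 hp hp3 x) = heckeOneR h9 hp hp3 (toFibre N h9 R x) := by
  rw [toFibre_apply, toFibre_apply, heckeOneR_tmul]

/-- Integer scalars pass through the fibre map: `k̄ · (1 ⊗ x) = 1 ⊗ (k x)`.
[cite: Stammbach1973HomologyGroupTheory, II.3 (3.11)] -/
theorem intCast_smul_toFibre (k : ℤ) (x : shiftSubOneLattice N h9) :
    (k : R) • toFibre N h9 R x = toFibre N h9 R (k • x) := by
  rw [toFibre_apply, toFibre_apply, TensorProduct.smul_tmul', smul_eq_mul, mul_one, ← zsmul_one,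
    TensorProduct.smul_tmul]

/-- `r ⊗ x = r · (1 ⊗ x)`. [cite: HatcherAT2002, §3.A Cor. 3A.4] -/
theorem tmul_eq_smul_toFibre (r : R) (x : shiftSubOneLattice N h9) :
    r ⊗ₜ[ℤ] x = r • toFibre N h9 R x := by
  rw [toFibre_apply, TensorProduct.smul_tmul', smul_eq_mul, mul_one]

/-- **`V₁(R)` is generated over `R` by the classes `1 ⊗ x`, `x ∈ Λ₁`.** [cite: HatcherAT2002, §3.A Cor. 3A.4] -/
theorem span_range_toFibre : Submodule.span R (Set.range (toFibre N h9 R)) = ⊤ := by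
  rw [eq_top_iff]
  rintro v -
  induction v using TensorProduct.induction_on with
  | zero => exact Submodule.zero_mem _
  | tmul r x =>
    rw [tmul_eq_smul_toFibre]
    exact Submodule.smul_mem _ r (Submodule.subset_span ⟨x, rfl⟩)
  | add a b ha hb => exact Submodule.add_mem _ ha hb

/-- **Reduction mod `n` is onto**: every element of `V₁(ℤ/n)` is a class `1 ⊗ x` (`k̄ ⊗ x = 1 ⊗ kx`).
[cite: Stammbach1973HomologyGroupTheory, II.3 (3.11)] -/
theorem toFibre_zmod_surjective (n : ℕ) : Function.Surjective (toFibre N h9 (ZMod n)) := by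
  intro v
  induction v using TensorProduct.induction_on with
  | zero => exact ⟨0, map_zero _⟩
  | tmul r x =>
    obtain ⟨k, rfl⟩ := ZMod.intCast_surjective r
    exact ⟨k • x, by rw [toFibre_apply, ← Literature.Algebra.Module.intCast_tmul]⟩
  | add a b ha hb =>
    obtain ⟨x, rfl⟩ := ha
    obtain ⟨y, rfl⟩ := hb
    exact ⟨x + y, map_add _ _ _⟩

/-- **The kernel of reduction mod `n` is `nΛ₁`**: `1 ⊗ x = 0` in `ℤ/n ⊗ Λ₁` iff `x = n y` (`ℤ/n ⊗ M = M/nM`,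
the tree's `Literature.Algebra.Module.one_tmul_eq_zero_iff_exists_smul`).
[cite: Stammbach1973HomologyGroupTheory, II.3 (3.11)] -/
theorem toFibre_zmod_eq_zero_iff (n : ℕ) (x : shiftSubOneLattice N h9) :
    toFibre N h9 (ZMod n) x = 0 ↔ ∃ y : shiftSubOneLattice N h9, (n : ℤ) • y = x :=
  Literature.Algebra.Module.one_tmul_eq_zero_iff_exists_smul n x

/-- Two lattice vectors have the same reduction mod `n` iff they differ by an element of `nΛ₁`.
[cite: Stammbach1973HomologyGroupTheory, II.3 (3.11)] -/
theorem toFibre_zmod_eq_iff (n : ℕ) (x y : shiftSubOneLattice N h9) :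
    toFibre N h9 (ZMod n) x = toFibre N h9 (ZMod n) y ↔ ∃ z : shiftSubOneLattice N h9, (n : ℤ) • z = x - y := by
  rw [← sub_eq_zero, ← map_sub, toFibre_zmod_eq_zero_iff]

/-- Over `ℤ/n` every additive subgroup is a submodule: the `ℤ`-span and the `ℤ/n`-span of a set agree
(Mathlib `Submodule.restrictScalars_span`, `ℤ → ℤ/n` onto). [cite: Stammbach1973HomologyGroupTheory, II.3 (3.11) (derived reading)] -/
theorem restrictScalars_span_zmod (n : ℕ) (X : Set (ShiftSubOneModule N h9 (ZMod n))) :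
    (Submodule.span (ZMod n) X).restrictScalars ℤ = Submodule.span ℤ X := by
  refine Submodule.restrictScalars_span ℤ (ZMod n) (fun r ↦ ?_) X
  obtain ⟨k, rfl⟩ := ZMod.intCast_surjective r
  exact ⟨k, by simp⟩

/-- **Pull-back rule**: if a sublattice `G ≤ Λ₁` contains `nΛ₁`, then `x ∈ Λ₁` lies in `G` as soon as its
reduction `1 ⊗ x` lies in the `ℤ/n`-span of the reductions of `G` (`= Ḡ = G/nΛ₁`).
[cite: Stammbach1973HomologyGroupTheory, II.3 (3.11) (derived reading: ℤ/n ⊗ Λ₁ = Λ₁/nΛ₁ and the correspondence theorem)] -/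
theorem mem_of_toFibre_mem_span_image (n : ℕ) {G : Submodule ℤ (shiftSubOneLattice N h9)}
    (hG : ∀ y : shiftSubOneLattice N h9, (n : ℤ) • y ∈ G) {x : shiftSubOneLattice N h9}
    (hx : toFibre N h9 (ZMod n) x ∈ Submodule.span (ZMod n) (toFibre N h9 (ZMod n) '' (G : Set (shiftSubOneLattice N h9)))) :
    x ∈ G := by
  have hx' : toFibre N h9 (ZMod n) x ∈
      (Submodule.span (ZMod n) (toFibre N h9 (ZMod n) '' (G : Set (shiftSubOneLattice N h9)))).restrictScalars ℤ := hx
  rw [restrictScalars_span_zmod, Submodule.span_image, Submodule.span_eq] at hx'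
  obtain ⟨g, hg, hgx⟩ := Submodule.mem_map.mp hx'
  obtain ⟨z, hz⟩ := (toFibre_zmod_eq_iff N h9 n x g).mp hgx.symm
  have hxe : x = g + (n : ℤ) • z := by rw [hz]; abel
  rw [hxe]
  exact G.add_mem hg (hG z)

set_option maxHeartbeats 800000 in
-- instance unification on the sub-submodule tensor carrier `R ⊗ ↥(range (t_* − 1))` is whnf-heavy (cf. p662714)
/-- **Operator congruences descend to the fibre**: if a `ℤ`-linear `φ` on `Λ₁` and an `R`-linear `Φ` on
`V₁(R)` are intertwined by the fibre map (`Φ(1 ⊗ x) = 1 ⊗ φx`) and `φ ≡ c (mod G)` on `Λ₁` (`φx − cx ∈ G` for all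
`x`, `c ∈ ℤ`), then `Φ ≡ c (mod Ḡ)` on all of `V₁(R)`: `Φv − c·v ∈ span_R(Ḡ)` (`R = ℤ/n`: reduction mod `n`). (Used with `(φ, Φ) = (T_p, T_p), c = a_p`
and `(t, t), c = 1`.) [cite: Stammbach1973HomologyGroupTheory, II.3 (3.11) (derived reading: V₁(ℤ/n) is spanned by the classes 1 ⊗ x)] -/
theorem sub_smul_mem_span_image_of_forall (G : Submodule ℤ (shiftSubOneLattice N h9))
    (φ : Module.End ℤ (shiftSubOneLattice N h9)) (Φ : Module.End R (ShiftSubOneModule N h9 R))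
    (hΦ : ∀ x, Φ (toFibre N h9 R x) = toFibre N h9 R (φ x)) (c : ℤ)
    (hG : ∀ x, φ x - c • x ∈ G) (v : ShiftSubOneModule N h9 R) :
    Φ v - (c : R) • v ∈ Submodule.span R (toFibre N h9 R '' (G : Set (shiftSubOneLattice N h9))) := by
  -- work with the linear map `L = Φ − c` and its range (no element induction on the tensor product)
  set L : Module.End R (ShiftSubOneModule N h9 R) := Φ - (c : R) • (1 : Module.End R _) with hL
  have hLv : Φ v - (c : R) • v = L v := rfl
  have hrange : LinearMap.range L ≤ Submodule.span R (toFibre N h9 R '' (G : Set (shiftSubOneLattice N h9))) := by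
    rw [LinearMap.range_eq_map, ← span_range_toFibre N h9 R, Submodule.map_span, Submodule.span_le]
    rintro _ ⟨_, ⟨x, rfl⟩, rfl⟩
    have h2 : L (toFibre N h9 R x) = toFibre N h9 R (φ x - c • x) := by
      have e : L (toFibre N h9 R x) = Φ (toFibre N h9 R x) - (c : R) • toFibre N h9 R x := rfl
      rw [e, hΦ, intCast_smul_toFibre, map_sub]
    rw [SetLike.mem_coe, h2]
    exact Submodule.subset_span ⟨φ x - c • x, hG x, rfl⟩
  rw [hLv]
  exact hrange (LinearMap.mem_range_self L v)

end Fibre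

/-! ### §3 `3Λ₁ ⊆ (t − 1)Λ₁` -/

section Three

variable (N : ℕ) [NeZero N] (h9 : 3 ^ 2 ∣ N)

/-- **`3Λ₁ ⊆ (t − 1)Λ₁`**: on `Λ₁`, `(1 − t)² = −3t` (`one_sub_shiftOne_sq_apply`), so
`3·tz = (t − 1)((1 − t)z)` and `3x = 3t³x ∈ (t − 1)Λ₁`; hence `[ev(Λ₁) : ev((t − 1)Λ₁)]` is a power of `3`
for every period map. [cite: Harrison2011X0108, §2 (derived reading via (1 − t)² = −3t on ker(1 + t + t²))] -/
theorem three_smul_mem_range_shiftOne_sub_one (x : shiftSubOneLattice N h9) :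
    3 • x ∈ LinearMap.range (shiftOne N h9 - 1) := by
  have key : ∀ z : shiftSubOneLattice N h9, 3 • shiftOne N h9 z ∈ LinearMap.range (shiftOne N h9 - 1) := by
    intro z
    refine ⟨(1 - shiftOne N h9) z, ?_⟩
    have h := one_sub_shiftOne_sq_apply N h9 z
    have e : (shiftOne N h9 - 1) ((1 - shiftOne N h9) z) = -((1 - shiftOne N h9) ((1 - shiftOne N h9) z)) := by
      simp only [LinearMap.sub_apply, Module.End.one_apply, map_sub]
      abel
    rw [e, h, neg_neg]
  rw [← shiftOne_shiftOne_shiftOne N h9 x]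
  exact key _

/-- The same for a sublattice: any `G ≤ Λ₁` containing `(t − 1)Λ₁` contains `3Λ₁`.
[cite: Harrison2011X0108, §2 (derived reading, see `three_smul_mem_range_shiftOne_sub_one`)] -/
theorem three_smul_mem_of_range_le {G : Submodule ℤ (shiftSubOneLattice N h9)}
    (hG : LinearMap.range (shiftOne N h9 - 1) ≤ G) (x : shiftSubOneLattice N h9) : ((3 : ℕ) : ℤ) • x ∈ G := by
  rw [Nat.cast_smul_eq_nsmul]
  exact hG (three_smul_mem_range_shiftOne_sub_one N h9 x)

end Three

/-! ### §4 Hecke factoring on the fibre -/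

section Factoring

variable (N : ℕ) [NeZero N] (h9 : 3 ^ 2 ∣ N) (R : Type*) [CommRing R]

/-- The generalised isotypic piece `V₁[a^∞]` for a FINITE set `S`, re-indexed by the primes `p ≠ 3` of `S`
(a `Finset` of the subtype), as a finite meet of generalised eigenspaces — the shape of the tree's Fitting
corollary `CommutingFamily.map_biInf_maxGenEigenspace_eq_top`. [cite: DiamondShurman2005, §6.3 (derived reading: bookkeeping of the index set)] -/
theorem genIsotypicOne_eq_biInf (S : Finset ℕ) (a : ℕ → R) :
    genIsotypicOne N h9 R (↑S) a =
      ⨅ i ∈ S.subtype (fun p : ℕ ↦ p.Prime ∧ p ≠ 3),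
        (heckeOneR h9 i.2.1 i.2.2 (R := R)).maxGenEigenspace (a i.1) := by
  ext v
  simp only [genIsotypicOne, Submodule.mem_iInf, Finset.mem_coe]
  constructor
  · intro h i hi
    exact h i.1 i.2.1 i.2.2 (Finset.mem_subtype.mp hi)
  · intro h p hp hp3 hpS
    exact h ⟨p, hp, hp3⟩ (Finset.mem_subtype.mpr hpS)

variable {N R} in
/-- The Hecke operators on `V₁(R)` pairwise commute, as `Commute` in `End_R(V₁(R))`.
[cite: DiamondShurman2005, Prop. 5.2.4] -/
theorem commute_heckeOneR {p q : ℕ} (hp : p.Prime) (hp3 : p ≠ 3) (hq : q.Prime) (hq3 : q ≠ 3) :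
    Commute (heckeOneR h9 hp hp3 (R := R)) (heckeOneR h9 hq hq3) := by
  change heckeOneR h9 hp hp3 (R := R) * heckeOneR h9 hq hq3 = heckeOneR h9 hq hq3 * heckeOneR h9 hp hp3
  rw [Module.End.mul_eq_comp, Module.End.mul_eq_comp]
  exact heckeOneR_comm h9 hp hp3 hq hq3

/-- **Hecke factoring on the fibre**: for a finite coefficient ring `R` (so `V₁(R)` is Artinian), a finite set
of primes `S`, scalars `a_p ∈ R`, and an `R`-linear SURJECTION `π : V₁(R) ↠ Q` killing some power of each
`T_p − a_p` (`p ∈ S`, `p ≠ 3` prime), the generalised eigenspace alone maps onto `Q`: `π(V₁[a^∞]) = Q`.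
(Fitting; no hypothesis that the `T_p`-eigenvalues lie in `R`.) [cite: Jacobson1989BasicAlgebraII, §3.4 Fitting's lemma (38), p. 113 (derived reading: the tree's `CommutingFamily.map_biInf_maxGenEigenspace_eq_top` applied to the commuting family (T_p)_{p ∈ S, p ≠ 3} on V₁(R))] -/
theorem map_genIsotypicOne_eq_top [Finite R] {Q : Type*} [AddCommGroup Q] [Module R Q] (S : Finset ℕ)
    (a : ℕ → R) (π : ShiftSubOneModule N h9 R →ₗ[R] Q) (hπ : Function.Surjective π)
    (hnil : ∀ (p : ℕ) (hp : p.Prime) (hp3 : p ≠ 3), p ∈ S →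
      ∃ n : ℕ, π ∘ₗ ((heckeOneR h9 hp hp3 (R := R) - a p • (1 : Module.End R _)) ^ n) = 0) :
    (genIsotypicOne N h9 R (↑S) a).map π = ⊤ := by
  haveI := isArtinian_shiftSubOneModule N h9 R
  rw [genIsotypicOne_eq_biInf]
  refine Literature.LinearAlgebra.CommutingFamily.map_biInf_maxGenEigenspace_eq_top _
    (fun i : {p : ℕ // p.Prime ∧ p ≠ 3} ↦ heckeOneR h9 i.2.1 i.2.2 (R := R)) (fun i ↦ a i.1)
    (fun i _ j _ ↦ commute_heckeOneR h9 i.2.1 i.2.2 j.2.1 j.2.2) π hπ fun i hi ↦ ?_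
  exact hnil i.1 i.2.1 i.2.2 (Finset.mem_subtype.mp hi)

/-- **The punch line**: let `R` be finite, `S` a finite set of primes, `a_p ∈ R`, and `W ≤ V₁(R)` a submodule
modulo which every `T_p` (`p ∈ S`, `p ≠ 3`) acts as the scalar `a_p` (`T_p v − a_p v ∈ W` for all `v`). If `W`
contains the generalised eigenspace `V₁[a^∞]`, then `W = V₁(R)`. (Apply `map_genIsotypicOne_eq_top` to
`π = V₁ ↠ V₁/W`; bsd-idea-3 memo §13.10 (iii): with `W ⊇ (1 − t̄)V₁ ⊇ V₁[ā^∞]` this is the mod-3 step of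
`PS_of`.) [cite: Jacobson1989BasicAlgebraII, §3.4 Fitting's lemma (38), p. 113 (derived reading via `map_genIsotypicOne_eq_top`)] -/
theorem eq_top_of_genIsotypicOne_le [Finite R] (S : Finset ℕ) (a : ℕ → R)
    (W : Submodule R (ShiftSubOneModule N h9 R))
    (hW : ∀ (p : ℕ) (hp : p.Prime) (hp3 : p ≠ 3), p ∈ S → ∀ v, heckeOneR h9 hp hp3 v - a p • v ∈ W)
    (hsat : genIsotypicOne N h9 R (↑S) a ≤ W) : W = ⊤ := by
  have hnil : ∀ (p : ℕ) (hp : p.Prime) (hp3 : p ≠ 3), p ∈ S →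
      ∃ n : ℕ, W.mkQ ∘ₗ ((heckeOneR h9 hp hp3 (R := R) - a p • (1 : Module.End R _)) ^ n) = 0 := by
    intro p hp hp3 hpS
    refine ⟨1, ?_⟩
    rw [pow_one]
    refine LinearMap.ext fun v ↦ ?_
    exact (Submodule.Quotient.mk_eq_zero W).mpr (hW p hp hp3 hpS v)
  have h := map_genIsotypicOne_eq_top N h9 R S a W.mkQ (Submodule.mkQ_surjective W) hnil
  have h2 := (Submodule.map_mkQ_eq_top W (genIsotypicOne N h9 R (↑S) a)).mp h
  rwa [sup_eq_left.mpr hsat] at h2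

end Factoring

end Literature.NumberTheory.ModularSymbols

end
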